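import Summits.RiemannHypothesis.RiemannHypothesis.Theorems.CCIsolation
import Summits.RiemannHypothesis.RiemannHypothesis.Theorems.SemilocalSoninIneqOn
import Summits.RiemannHypothesis.RiemannHypothesis.Theorems.MotivicDoorSemilocalClosed
import Literature.NumberTheory.ConnesConsani2021.VanishingSetCriterion
import Literature.NumberTheory.ConnesConsani2021.WeilPropertyP
import Summits.RiemannHypothesis.Statement
import HarnessLib

/-!
# C1 isolation, II: positivity on Connes–Consani's Sonin vanishing class is ALSO RH-EQUIVALENT

**Label (line 1): RH-EQUIVALENT.**  Cell `rh-crit`, sub-cell `cc/`, seat `rh-crit-cc-iso`; `cc/ASSIGNMENTS.md` §4 (iii),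
`cc/TAUTOLOGY-TEST.md` (fork (a)/(b)/(c)).  bears_on: W-C/W-P.  Companion of `Theorems/CCIsolation.lean`
(same namespace; the theorems up to `soninClassSemilocal_of_semilocalSoninIneqOn` only need `weilPropertyP`;
the appended § "Links by name" imports it for the alias `IsolatedCC`).

Connes–Consani 2021 (Selecta Math. 27, Thm. 1 p. 4; arXiv:2006.13771) work on the VANISHING CLASS of test
functions `g` with `ĝ(i/2) = 0` (this kills the polar term of `W(g ∗ g*)`) and `ĝ(0) = 0` (Sonin's condition);
in the tree's Mellin normalisation these are `weilMellin g 1 = 0` and `weilMellin g (1/2) = 0`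
(`mulFourier_I_half`, `mulFourier_zero`).  The semi-local programme (CC 2021 Intro p. 3; CCM 2024 p. 3) asks for
`W_S(g ∗ g*) ≥ Tr(ϑ(g) 𝔖_S ϑ(g)*)` on this class, `S = {∞, 2, …, p}`, `Support(g ∗ g*) ⊂ (p⁻¹, p)`.  This file
records, as kernel theorems with RH-FREE proofs, where that programme touches RH:

* `riemannHypothesis_iff_soninClass` — **RH ⟺ `0 ≤ Re W(g ⋆ g̃)` for every test `g` in CC's Sonin class**
  (window-free).  DERIVED, not re-proved: it is CC 2021 App. C Prop. 46 (finite vanishing set `F ∋ 0` disjoint from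
  the zeros: `RH ⟺ Σ_v 𝒲_v(g ∗ ḡ♯) ≤ 0` on the tests with `g̃|_F = 0`), typed and PROVED by seat cc-t8 as
  `Literature.NumberTheory.ConnesConsani2021.riemannHypothesis_iff_bombieriLocalSum_nonpos_real`
  (`VanishingSetCriterion.lean`, fact `CC2021_prop_C46` discharged in-file), at `F = {0, ½, 1}` — the Sonin class
  `{ĝ(1) = ĝ(½) = 0}` contains the `F`-class, and on it `Σ_v 𝒲_v(g ∗ ḡ♯) = −Q(g)`
  (`bombieriLocalSum_convReflect_re_nonpos_iff`); `ζ` has no real zeros in `(0,1)`, so `F ∩ Z = ∅` is automatic.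
* `riemannHypothesis_iff_forall_soninClassWindow` — the same coupled over the windows `(log n)/2`, `n : ℕ`
  (re-indexing; every test lives in some window).
* `weilSemilocalQuadratic_eq_semilocalWeilSide` — on the class `ĝ(i/2) = 0` the semi-local form `Q_S(g)` IS
  CC's semi-local Weil side `W_∞(g ∗ g*) − Σ_{p ∈ S} W_p(g ∗ g*)` (`archW − weilSemilocalPrimeTerm S`), for every
  finite `S`, with no support restriction.
* `riemannHypothesis_iff_forall_prime_soninClassSemilocal` — **RH ⟺ for every prime `q` and every test `g` in the
  Sonin class of the window `(log q)/2`: `0 ≤ Re(W_∞(g ∗ g*) − Σ_{p<q} W_p(g ∗ g*))`** — the SCALAR (empty-family)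
  shadow of the would-be "Theorem 1_S" coupled over `S(q) = {p < q}`.  So the scalar shadow of the semi-local
  programme is Weil positivity re-indexed once more (tautology test T-B), RH-EQUIVALENT, not a structural surplus.
* The TRACE strengthening itself (`Σ_i Re⟨ξ_i|ϑ(g∗g*)ξ_i⟩ ≤ Re(W_∞ − W_p)` over the semilocal Sonin space,
  `Summit.RiemannHypothesis.RiemannHypothesis.SemilocalSoninIneqOn`) would imply the scalar shadow
  (`SemilocalSoninIneqOn.scalar`), but its coupled family is REFUTED at its `q = 3` member `S = {∞,2}`,
  `a = (log 3)/2`: `Summit.RiemannHypothesis.RiemannHypothesis.SoninCert.not_semilocalSoninIneqOn_two_log_three_half`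
  (and for every `a > 1/2`: `SoninPoly.Frame050.not_semilocalSoninIneqOn_two_of_gt_half`) — cited, not restated.

WHAT THIS IS NOT: not a claim about RH, not a new conjecture, not a Literature fact; an equivalence is not a proof;
nothing here bears on the truth of RH.  No named facts, standard axioms.
-/

set_option linter.dupNamespace false  -- the mandated namespace repeats `RiemannHypothesis`

noncomputable section

open Set Complex
open scoped ComplexConjugate
open Literature.NumberTheory.LFunctions Literature.NumberTheory.LFunctions.WeilConverse
open Literature.NumberTheory.ConnesConsani2021

namespace Summit.RiemannHypothesis.RiemannHypothesis.Theorems.CCIsolation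

/-! ## Connes–Consani's Sonin vanishing class `ĝ(i/2) = 0 = ĝ(0)` (`weilMellin g 1 = 0 = weilMellin g (1/2)`) -/

/-- The Sonin class is stable under the dipoles `g + c·g(· − x)` (`(g + c g_x)^(s) = ĝ(s)(1 + c e^{(s−½)x})`) —
recorded for the route dossier; the criterion below does not need it separately (it is inside Prop. 46's proof).
[cite: ConnesConsani2021, Lemma 3.1 p. 12 (the vanishing conditions define an ideal of the convolution algebra)] -/
theorem soninClass_translateMix {g : ℝ → ℂ} (hg : IsWeilTest g)
    (hp : weilMellin g 1 = 0 ∧ weilMellin g (1 / 2) = 0) (c : ℂ) (x : ℝ) :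
    weilMellin (translateMix g c x) 1 = 0 ∧ weilMellin (translateMix g c x) (1 / 2) = 0 := by
  constructor
  · rw [weilMellin_translateMix hg, hp.1, zero_mul]
  · rw [weilMellin_translateMix hg, hp.2, zero_mul]

/-- **RH ⟺ Weil positivity on CC's Sonin class (Mellin coordinates)**: `0 ≤ Re W(g ⋆ g̃)` for every smooth
compactly supported `g` with `ĝ(1) = 0` and `ĝ(½) = 0`.  `⟹`: easy half of Weil's criterion; `⟸`: App. C
Prop. 46 at `F = {0, ½, 1}` (cc-t8's `riemannHypothesis_iff_bombieriLocalSum_nonpos_real`; the Sonin class contains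
the `F`-class, on which `Σ_v 𝒲_v(g ∗ ḡ♯) = −Q(g)`). [cite: ConnesConsani2021, App. C Prop. 46 (arXiv item 46, p. 32; F ⊇ {0,1} finite, F ∩ Z = ∅); Bombieri2000Weil Thms. 1–2] -/
theorem riemannHypothesis_iff_soninClass_mellin :
    _root_.RiemannHypothesis ↔ ∀ g : ℝ → ℂ, IsWeilTest g → weilMellin g 1 = 0 → weilMellin g (1 / 2) = 0 →
      0 ≤ (weilQuadratic g).re := by
  refine ⟨fun h g hg _ _ ↦ weil_criterion_holds.1 h g hg, fun H ↦ ?_⟩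
  have hF : ({0, 1 / 2, 1} : Set ℂ).Finite := Set.toFinite _
  have h0 : (0 : ℂ) ∈ ({0, 1 / 2, 1} : Set ℂ) := by simp
  have hreal : ∀ z ∈ ({0, 1 / 2, 1} : Set ℂ), z.im = 0 := by
    intro z hz
    simp only [Set.mem_insert_iff, Set.mem_singleton_iff] at hz
    rcases hz with rfl | rfl | rfl <;> simp
  refine (riemannHypothesis_iff_bombieriLocalSum_nonpos_real hF h0 hreal).2 fun g hg hFg ↦ ?_
  exact (bombieriLocalSum_convReflect_re_nonpos_iff hg (hFg 0 h0)).2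
    (H g hg (hFg 1 (by simp)) (hFg (1 / 2) (by simp)))

/-- **RH ⟺ Weil positivity on CC's Sonin class** in CC's coordinates `ĝ(i/2) = 0`, `ĝ(0) = 0` (`mulFourier`).
RH-EQUIVALENT; window-free. [cite: ConnesConsani2021, Thm. 1 p. 4 (the vanishing class) and App. C Prop. 46 p. 32; Bombieri2000Weil Thms. 1–2] -/
theorem riemannHypothesis_iff_soninClass :
    _root_.RiemannHypothesis ↔ ∀ g : ℝ → ℂ, IsWeilTest g → mulFourier g (I / 2) = 0 → mulFourier g 0 = 0 →
      0 ≤ (weilQuadratic g).re := by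
  simp only [mulFourier_I_half, mulFourier_zero]
  exact riemannHypothesis_iff_soninClass_mellin

/-- Every test function lives in the window `[−(log n)/2, (log n)/2]` of some `n : ℕ`. [folklore] -/
theorem exists_tsupport_subset_natWindow {g : ℝ → ℂ} (hg : IsWeilTest g) :
    ∃ n : ℕ, tsupport g ⊆ Icc (-(Real.log n / 2)) (Real.log n / 2) := by
  obtain ⟨R, hR⟩ := hg.2.isCompact.isBounded.subset_closedBall 0
  rw [Real.closedBall_eq_Icc, zero_sub, zero_add] at hR
  refine ⟨⌈Real.exp (2 * max R 0)⌉₊, hR.trans ?_⟩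
  have h1 : Real.exp (2 * max R 0) ≤ (⌈Real.exp (2 * max R 0)⌉₊ : ℝ) := Nat.le_ceil _
  have h2 : 2 * max R 0 ≤ Real.log (⌈Real.exp (2 * max R 0)⌉₊ : ℕ) := by
    have := Real.log_le_log (Real.exp_pos _) h1
    rwa [Real.log_exp] at this
  have h3 : R ≤ Real.log (⌈Real.exp (2 * max R 0)⌉₊ : ℕ) / 2 := by
    linarith [le_max_left R 0]
  exact Icc_subset_Icc (neg_le_neg h3) h3

/-- **RH ⟺ Sonin-class positivity on every window** `(log n)/2`, `n : ℕ` (re-indexing of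
`riemannHypothesis_iff_soninClass`: every test lives in some window). RH-EQUIVALENT. [cite: ConnesConsani2021, Intro p. 3 (Support(f) ⊂ (p⁻¹, p)) and Thm. 1 p. 4; Bombieri2000Weil Thms. 1–2] -/
theorem riemannHypothesis_iff_forall_soninClassWindow :
    _root_.RiemannHypothesis ↔ ∀ n : ℕ, ∀ g : ℝ → ℂ, IsWeilTest g →
      tsupport g ⊆ Icc (-(Real.log n / 2)) (Real.log n / 2) →
        mulFourier g (I / 2) = 0 → mulFourier g 0 = 0 → 0 ≤ (weilQuadratic g).re := by
  rw [riemannHypothesis_iff_soninClass]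
  refine ⟨fun h n g hg _ h1 h0 ↦ h g hg h1 h0, fun h g hg h1 h0 ↦ ?_⟩
  obtain ⟨n, hn⟩ := exists_tsupport_subset_natWindow hg
  exact h n g hg hn h1 h0

/-- Sonin-class positivity on the windows implies `∀ n, P(n)` (= `IsolatedCC`, `CCIsolation.isolatedCC_iff`); `P(n)`
asks positivity on the class `ĝ(±i/2) = 0` instead, and the implication runs through RH
(`weilPropertyP_of_riemannHypothesis`). [cite: Connes2026Letter, §4.1 p. 17] -/
theorem forall_weilPropertyP_of_forall_soninClassWindow
    (h : ∀ n : ℕ, ∀ g : ℝ → ℂ, IsWeilTest g → tsupport g ⊆ Icc (-(Real.log n / 2)) (Real.log n / 2) →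
      mulFourier g (I / 2) = 0 → mulFourier g 0 = 0 → 0 ≤ (weilQuadratic g).re) :
    ∀ n : ℕ, weilPropertyP n :=
  weilPropertyP_of_riemannHypothesis (riemannHypothesis_iff_forall_soninClassWindow.2 h)

/-! ## The semi-local Weil side on the Sonin class -/

/-- **On the class `ĝ(i/2) = 0` the semi-local form IS CC's semi-local Weil side**:
`Q_S(g) = W_∞(g ∗ g*) − Σ_{p ∈ S} W_p(g ∗ g*)` (`archW − weilSemilocalPrimeTerm S` of `k = g ⋆ g̃`) — the polar
term `2 Re(ĝ(0) conj ĝ(1))` dies and `W_∞ = archW` (`weilArchTermBombieri_eq_weilArchTerm_holds`); any finite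
`S`, no support restriction. [cite: ConnesConsani2021, Intro p. 5 (f̂(i/2) = 0 kills the pole contribution); ConnesConsani2023 §2.1.2] -/
theorem weilSemilocalQuadratic_eq_semilocalWeilSide (S : Finset ℕ) {g : ℝ → ℂ} (hg : IsWeilTest g)
    (h1 : mulFourier g (I / 2) = 0) :
    weilSemilocalQuadratic S g =
      archW (weilConv g (weilReflect g)) - weilSemilocalPrimeTerm S (weilConv g (weilReflect g)) := by
  rw [mulFourier_I_half] at h1
  have hk : IsWeilTest (weilConv g (weilReflect g)) := hg.weilConv hg.weilReflect
  have hA : archW (weilConv g (weilReflect g)) = weilArchTerm (weilConv g (weilReflect g)) :=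
    weilArchTermBombieri_eq_weilArchTerm_holds hk
  unfold weilSemilocalQuadratic weilSemilocalFunctional
  rw [weilPolarTerm_weilConv_weilReflect hg, h1, map_zero, mul_zero, hA]
  simp only [Complex.zero_re, mul_zero, Complex.ofReal_zero, zero_sub]
  ring

/-- **RH ⟺ the scalar shadow of the semi-local programme, prime windows**: for every prime `q` and every test
`g` in CC's Sonin class supported in `[−(log q)/2, (log q)/2]`, `0 ≤ Re(W_∞(g ∗ g*) − Σ_{p<q} W_p(g ∗ g*))`
(the `n = 0` case of a "Theorem 1_S" at `S = {∞} ∪ {p < q}`).  RH-EQUIVALENT (T-B: below the next prime the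
semi-local side is `Q(g)`, `weilSemilocalQuadratic_eq_weilQuadratic_of_forall`; cf. `CCIsolation.weilSemilocalQuadratic_primesBelow_eq_weilQuadratic`).  The trace strengthening's
`q = 3` member is refuted in the tree (`SoninCert.not_semilocalSoninIneqOn_two_log_three_half`).
[cite: ConnesConsani2021, Intro p. 3 (semi-local framework {∞,2,…,p}, Support(f) ⊂ (p⁻¹,p)) and Thm. 1 p. 4; Bombieri2000Weil Thms. 1–2] -/
theorem riemannHypothesis_iff_forall_prime_soninClassSemilocal :
    _root_.RiemannHypothesis ↔ ∀ q : ℕ, q.Prime → ∀ g : ℝ → ℂ, IsWeilTest g →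
      tsupport g ⊆ Icc (-(Real.log q / 2)) (Real.log q / 2) →
        mulFourier g (I / 2) = 0 → mulFourier g 0 = 0 →
        0 ≤ (archW (weilConv g (weilReflect g))
          - weilSemilocalPrimeTerm q.primesBelow (weilConv g (weilReflect g))).re := by
  -- below the prime `q = N + 1` the semi-local side on the class `ĝ(i/2) = 0` is `Q(g)`
  have key : ∀ N : ℕ, ∀ g : ℝ → ℂ, IsWeilTest g →
      tsupport g ⊆ Icc (-(Real.log ((N + 1 : ℕ) : ℝ) / 2)) (Real.log ((N + 1 : ℕ) : ℝ) / 2) →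
        mulFourier g (I / 2) = 0 →
        archW (weilConv g (weilReflect g))
          - weilSemilocalPrimeTerm (N + 1).primesBelow (weilConv g (weilReflect g)) = weilQuadratic g := by
    intro N g hg hsupp h1
    push_cast at hsupp
    rw [← weilSemilocalQuadratic_eq_semilocalWeilSide _ hg h1,
      weilSemilocalQuadratic_eq_weilQuadratic_of_forall hg
        (fun n hn _ ↦ MotivicDoor.Semilocal.primeFactors_subset_primesBelow hn) hsupp]
  rw [riemannHypothesis_iff_soninClass]
  constructor
  · intro h q hq g hg hsupp h1 h0
    obtain ⟨N, rfl⟩ : ∃ N, q = N + 1 := ⟨q - 1, (Nat.succ_pred_eq_of_pos hq.pos).symm⟩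
    rw [key N g hg hsupp h1]
    exact h g hg h1 h0
  · intro h g hg h1 h0
    obtain ⟨n, hn⟩ := exists_tsupport_subset_natWindow hg
    obtain ⟨q, hnq, hq⟩ := Nat.exists_infinite_primes n
    have hl : Real.log n / 2 ≤ Real.log q / 2 := by
      rcases Nat.eq_zero_or_pos n with rfl | hn0
      · have h0' := Real.log_natCast_nonneg q
        simp only [Nat.cast_zero, Real.log_zero, zero_div]
        linarith
      · have := Real.log_le_log (by exact_mod_cast hn0) (by exact_mod_cast hnq : (n : ℝ) ≤ q)
        linarith
    have hsupp := hn.trans (Icc_subset_Icc (neg_le_neg hl) hl)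
    have hpos := h q hq g hg hsupp h1 h0
    obtain ⟨N, rfl⟩ : ∃ N, q = N + 1 := ⟨q - 1, (Nat.succ_pred_eq_of_pos hq.pos).symm⟩
    rwa [key N g hg hsupp h1] at hpos

/-- The TRACE strengthening implies the scalar shadow: `SemilocalSoninIneqOn p a` (the `S = {∞, p}`
"Theorem 1_S" shape) gives the Sonin-class semi-local positivity of `Q_{{p}}` on `C(a)` (empty family,
`SemilocalSoninIneqOn.scalar`).  Recorded to make the fork explicit: scalar shadow RH-EQUIVALENT (above), trace
family refuted at `p = 2`, `a = (log 3)/2` (`SoninCert.not_semilocalSoninIneqOn_two_log_three_half`).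
[cite: ConnesConsani2021, Thm. 1 p. 4 (trace ≥ 0 ⇒ positivity)] -/
theorem soninClassSemilocal_of_semilocalSoninIneqOn {p : ℕ} [Fact p.Prime] {a : ℝ}
    (h : SemilocalSoninIneqOn p a) {g : ℝ → ℂ} (hg : IsWeilTest g) (hsupp : tsupport g ⊆ Icc (-a) a)
    (h1 : mulFourier g (I / 2) = 0) (h0 : mulFourier g 0 = 0) :
    0 ≤ (weilSemilocalQuadratic {p} g).re := by
  rw [weilSemilocalQuadratic_eq_semilocalWeilSide _ hg h1]
  exact h.scalar hg hsupp h1 h0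

/-! ## Links by name (append, 2026-08-26): `IsolatedCC` ↔ the Sonin-class / CC-vanishing-class spellings

RH-EQUIVALENT bookkeeping (label line 1), requested on `cc/STATUS.md` (cc-t8 03:13Z/03:22Z: "alias
`riemannHypothesis_iff_weilQuadratic_nonneg_ccVanishing` for §4 (iii)"; seat HANDOFF: the prime-window corollary for the
route dossier «ConnesConsaniSemilocal» by name).  Every statement below is `IsolatedCC ↔ X` with `X` one of the classes
already shown `↔ RH` above or in `VanishingSetCriterion.lean`; each proof is ONE `Iff.trans` through
`isolatedCC_iff_riemannHypothesis` — i.e. these equivalences hold ONLY GLOBALLY (all windows at once), through RH; per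
window the classes `{ĝ(±i/2) = 0}` (pole-free, `P(n)`), `{ĝ(i/2) = ĝ(0) = 0}` (Sonin) and their intersection are
different statements, and only the trivial per-window inclusion `weilPropertyP_imp_ccVanishingWindow` is RH-free.
Tautology test: T-B throughout (re-indexings of Weil positivity); no structural surplus.  Nothing is re-proved; no defs,
no named facts.  WHAT THIS IS NOT: a claim about RH — nothing here bears on the truth of RH. -/

/-- **`IsolatedCC ↔` Weil positivity on CC's Sonin class** `{ĝ(i/2) = 0, ĝ(0) = 0}` (window-free; CC's Fourier
coordinates).  RH-EQUIVALENT (T-B); `= isolatedCC_iff_riemannHypothesis.trans riemannHypothesis_iff_soninClass`.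
[cite: ConnesConsani2021, Thm. 1 p. 4 (the vanishing class) and App. C Prop. C.1 (= arXiv item 46, PDF p. 51); Connes2026Letter §4.1 p. 17] -/
theorem isolatedCC_iff_soninClass :
    IsolatedCC ↔ ∀ g : ℝ → ℂ, IsWeilTest g → mulFourier g (I / 2) = 0 → mulFourier g 0 = 0 →
      0 ≤ (weilQuadratic g).re :=
  isolatedCC_iff_riemannHypothesis.trans riemannHypothesis_iff_soninClass

/-- `IsolatedCC ↔` Sonin-class positivity on every window `(log n)/2` — `P(n)` with Sonin's condition `ĝ(0) = 0` in
place of the second pole `ĝ(−i/2) = 0`, all `n`.  RH-EQUIVALENT (T-B). [cite: ConnesConsani2021, Intro p. 3 and Thm. 1 p. 4; Connes2026Letter §4.1 p. 17] -/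
theorem isolatedCC_iff_forall_soninClassWindow :
    IsolatedCC ↔ ∀ n : ℕ, ∀ g : ℝ → ℂ, IsWeilTest g →
      tsupport g ⊆ Icc (-(Real.log n / 2)) (Real.log n / 2) →
        mulFourier g (I / 2) = 0 → mulFourier g 0 = 0 → 0 ≤ (weilQuadratic g).re :=
  isolatedCC_iff_riemannHypothesis.trans riemannHypothesis_iff_forall_soninClassWindow

/-- **`IsolatedCC ↔` the scalar shadow of the semi-local programme at the prime windows**: for every prime `q`
and every test `g` in the Sonin class of the window `(log q)/2`, `0 ≤ Re(W_∞(g ∗ g*) − Σ_{p<q} W_p(g ∗ g*))`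
(`S(q) = {∞} ∪ {p < q}`).  The corollary recorded for the route dossier «ConnesConsaniSemilocal» (residual of record
`IsolatedCC` as an aside); RH-EQUIVALENT (T-B: below the next prime the semi-local side IS `Q(g)`).  The TRACE
strengthening's `q = 3` member is refuted in the tree (`SoninCert.not_semilocalSoninIneqOn_two_log_three_half`).
[cite: ConnesConsani2021, Intro p. 3 (semi-local framework {∞,2,…,p}, Support(f) ⊂ (p⁻¹,p)); ConnesConsani2023 §2.1.2; Bombieri2000Weil Thms. 1–2] -/
theorem isolatedCC_iff_forall_prime_soninClassSemilocal :
    IsolatedCC ↔ ∀ q : ℕ, q.Prime → ∀ g : ℝ → ℂ, IsWeilTest g →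
      tsupport g ⊆ Icc (-(Real.log q / 2)) (Real.log q / 2) →
        mulFourier g (I / 2) = 0 → mulFourier g 0 = 0 →
        0 ≤ (archW (weilConv g (weilReflect g))
          - weilSemilocalPrimeTerm q.primesBelow (weilConv g (weilReflect g))).re :=
  isolatedCC_iff_riemannHypothesis.trans riemannHypothesis_iff_forall_prime_soninClassSemilocal

/-- The detecting direction by name: Sonin-class semi-local positivity at every prime window gives `IsolatedCC`
(through RH: `riemannHypothesis_iff_forall_prime_soninClassSemilocal`, then Bombieri's easy half). [cite: Bombieri2000Weil, Thms. 1–2] -/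
theorem isolatedCC_of_forall_prime_soninClassSemilocal
    (h : ∀ q : ℕ, q.Prime → ∀ g : ℝ → ℂ, IsWeilTest g →
      tsupport g ⊆ Icc (-(Real.log q / 2)) (Real.log q / 2) →
        mulFourier g (I / 2) = 0 → mulFourier g 0 = 0 →
        0 ≤ (archW (weilConv g (weilReflect g))
          - weilSemilocalPrimeTerm q.primesBelow (weilConv g (weilReflect g))).re) :
    IsolatedCC :=
  isolatedCC_iff_forall_prime_soninClassSemilocal.2 h

/-- **`IsolatedCC ↔` Weil positivity on CC's full vanishing class `g̃(0) = g̃(1/2) = g̃(1) = 0`** (Mellin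
coordinates) — the alias of cc-t8's `riemannHypothesis_iff_weilQuadratic_nonneg_ccVanishing` (App. C Prop. C.1 at
`F = {0, ½, 1}`) asked for on `cc/STATUS.md`; the weakest of the class hypotheses in this file (three vanishing
conditions).  RH-EQUIVALENT (T-B). [cite: ConnesConsani2021, App. C Prop. C.1 (= arXiv item 46, PDF p. 51) and Intro p. 4 (ξ(1/2 + is) ≠ 0 for s = 0, i/2)] -/
theorem isolatedCC_iff_weilQuadratic_nonneg_ccVanishing :
    IsolatedCC ↔ ∀ g : ℝ → ℂ, IsWeilTest g → weilMellin g 0 = 0 → weilMellin g (1 / 2) = 0 →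
      weilMellin g 1 = 0 → 0 ≤ (weilQuadratic g).re :=
  isolatedCC_iff_riemannHypothesis.trans riemannHypothesis_iff_weilQuadratic_nonneg_ccVanishing

/-- The same class in CC's Fourier coordinates: `IsolatedCC ↔` positivity on `{ĝ(i/2) = ĝ(−i/2) = ĝ(0) = 0}` =
(`P(n)`'s pole-free class) ∩ (Sonin's condition), window-free (`mulFourier_I_half`, `mulFourier_neg_I_half`,
`mulFourier_zero`).  RH-EQUIVALENT (T-B). [cite: ConnesConsani2021, App. C Prop. C.1 (= arXiv item 46, PDF p. 51); Connes2026Letter §4.1 p. 17 (ĝ(±i/2) = 0)] -/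
theorem isolatedCC_iff_ccVanishingClass :
    IsolatedCC ↔ ∀ g : ℝ → ℂ, IsWeilTest g → mulFourier g (I / 2) = 0 → mulFourier g (-(I / 2)) = 0 →
      mulFourier g 0 = 0 → 0 ≤ (weilQuadratic g).re := by
  simp only [mulFourier_I_half, mulFourier_neg_I_half, mulFourier_zero]
  rw [isolatedCC_iff_weilQuadratic_nonneg_ccVanishing]
  exact ⟨fun h g hg h1 h0 hh ↦ h g hg h0 hh h1, fun h g hg h0 hh h1 ↦ h g hg h1 h0 hh⟩

/-- RH-FREE and per window (the only window-local link): `P(n)` implies `P(n)` restricted to Sonin's condition —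
the class shrinks, the conclusion is the same. [cite: Connes2026Letter, §4.1 p. 17 (P(n)); ConnesConsani2021 Thm. 1 p. 4 (Sonin's condition ĝ(0) = 0)] -/
theorem weilPropertyP_imp_ccVanishingWindow {n : ℕ} (h : weilPropertyP n) :
    ∀ g : ℝ → ℂ, IsWeilTest g → tsupport g ⊆ Icc (-(Real.log n / 2)) (Real.log n / 2) →
      mulFourier g (I / 2) = 0 → mulFourier g (-(I / 2)) = 0 → mulFourier g 0 = 0 →
        0 ≤ (weilQuadratic g).re :=
  fun g hg hsupp h1 h2 _ ↦ h g hg hsupp h1 h2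

/-- **`IsolatedCC ↔ ∀ n, P(n)` restricted to CC's full vanishing class** `{ĝ(±i/2) = 0, ĝ(0) = 0}` on the window
`(log n)/2` — the sharpest windowed spelling in this file: per window it is implied by `P(n)`
(`weilPropertyP_imp_ccVanishingWindow`, RH-free), and all windows together give back RH (App. C Prop. C.1 at
`F = {0, ½, 1}`: every test lives in some window) hence `IsolatedCC`.  RH-EQUIVALENT (T-B). [cite: ConnesConsani2021, App. C Prop. C.1 (= arXiv item 46, PDF p. 51) and Intro p. 3 (Support(f) ⊂ (p⁻¹, p)); Connes2026Letter §4.1 p. 17] -/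
theorem isolatedCC_iff_forall_ccVanishingWindow :
    IsolatedCC ↔ ∀ n : ℕ, ∀ g : ℝ → ℂ, IsWeilTest g →
      tsupport g ⊆ Icc (-(Real.log n / 2)) (Real.log n / 2) →
        mulFourier g (I / 2) = 0 → mulFourier g (-(I / 2)) = 0 → mulFourier g 0 = 0 →
        0 ≤ (weilQuadratic g).re := by
  refine ⟨fun h n ↦ weilPropertyP_imp_ccVanishingWindow (h n), fun h ↦ isolatedCC_iff_ccVanishingClass.2 ?_⟩
  intro g hg h1 h2 h0
  obtain ⟨n, hn⟩ := exists_tsupport_subset_natWindow hg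
  exact h n g hg hn h1 h2 h0

end Summit.RiemannHypothesis.RiemannHypothesis.Theorems.CCIsolation

end
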